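import Literature.Geometry.Lorentzian.KerrSchildDivergence
import Literature.Geometry.Lorentzian.KerrSchildWaveCauchyProblem
import HarnessLib

/-!
# Past-directed causal curves in the Kerr exterior do not reach the future event horizon at
# finite `t*`: the hypersurfaces `{r = r_in(t*)}` with `ṙ_in ≥ Δ(r)/(4Mr)` have past causal
# outward conormal

(family `gr`; infrastructure for the domain of dependence of the leaves `{t* = const}` of the
ingoing Kerr–Schild chart near `𝓗⁺`, namespace `Literature.Geometry.Lorentzian.Kerr`)

In the ingoing Kerr–Schild chart `g = η + 2H ℓ ⊗ ℓ` of `Kerr.exterior M a = {r > r₊}` the outgoing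
light cones degenerate at the future event horizon `𝓗⁺ = {r = r₊}`: along future-directed causal
curves `dr/dt* ≥ −c_in` but `dr/dt* ≤ c_out(r, θ)` with `c_out → 0` as `r ↓ r₊`; dually, past-directed
causal curves starting in the exterior cannot decrease `r` faster than `c_out`, which is
`O(r − r₊)`, so they stay in `{r > r₊}` for all finite `t*` (the leaves `{t* = τ} ∩ {r > r₊}` are
past Cauchy hypersurfaces of `{t* ≥ τ} ∩ {r > r₊}`; Dafermos–Rodnianski–Shlapentokh-Rothman,
arXiv:1402.7034, §2.2.5). This file proves the quantitative covector form of this fact which the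
energy method consumes (`KerrSchildLocalEnergy.lean`, `KerrSchildDominantEnergy.lean`):

* `Kerr.horizonCovector_causal` — at a point with `r > 0` of a generalised Kerr–Schild background
  whose profile there is the Kerr profile `2H = 2Mr/Σ`, the covector `ν = s dt* − dr`
  (`dr = ⟨∇r, dy⃗⟩`, `∇r` the Euclidean gradient of the Kerr–Schild radius, `Kerr.radiusGradVec`)
  satisfies `Σ · g⁻¹(ν, ν) = −(Σ + 2Mr) s² − 4Mr s + Δ`, `Δ = r² − 2Mr + a²`, by the two identities
  `|∇r|² = (r² + a²)/Σ` (`Kerr.inner_radiusGradVec_self`) and `ℓ⃗·∇r = 1`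
  (`Kerr.radiusGrad_nullSpatial`), and `g⁻¹(dt*, ν) = −(1 + 2H) s − 2H`; hence **`ν` is causal and
  co-oriented with `dt*` as soon as `s ≥ 0` and `Δ(r) ≤ 4 M r s`**. Consequently the outward
  conormal `ṙ_in dt* − dr` of the complement of `{r > r_in(t*)}` is past causal when
  `ṙ_in ≥ Δ(r)/(4Mr)`, e.g. for `r_in(t*) − r₊ ∝ e^{t*/(2M)}` in a layer `r ≤ 2 r_in − r₊`
  (`Δ(r)/(4Mr) ≤ (r − r₊)/(4M)` since `0 ≤ r₋`): such an inner boundary recedes from the horizon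
  only exponentially slowly into the past and never reaches it.

## References

* M. Dafermos, I. Rodnianski, Y. Shlapentokh-Rothman, *Decay for solutions of the wave equation
  on Kerr exterior spacetimes III*, arXiv:1402.7034, §2.1.1 (`Δ`, `r_±`), §2.2.5 (`Σ₀` is a past
  Cauchy hypersurface of `𝓡₀`) (key `DafermosRodnianskiShlapentokhrothman2014`).
* M. Visser, *The Kerr spacetime: a brief introduction*, arXiv:0706.0622, (33)–(35), §5
  (`g^{tt} = −1 − 2H`, the Kerr–Schild `r`) (key `arXiv07060622`).
* S. W. Hawking, G. F. R. Ellis, *The large scale structure of space-time*, CUP 1973, §4.3 and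
  §5.6 (causal structure of the Kerr solution) (key `HawkingEllis1973CUP`).
-/

noncomputable section

open Set Filter
open scoped Topology RealInnerProductSpace

namespace Literature.Geometry.Lorentzian.Kerr

/-- `ℓ⃗ · ∇r = 1` in components at a point `x` of `E4` with `r > 0`:
`ℓ₁ ∂₁r + ℓ₂ ∂₂r + ℓ₃ ∂₃r = 1` (`Kerr.radiusGrad_nullSpatial`). Visser arXiv:0706.0622,
(34)–(35). [cite: arXiv07060622, (34)–(35)] -/
theorem sum_nullCovectorFun_mul_radiusGradVec {a : ℝ} {x : E4} (hx : 0 < radius a x) :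
    nullCovectorFun a x 1 * radiusGradVec a (E4.spatial x) 0 +
        nullCovectorFun a x 2 * radiusGradVec a (E4.spatial x) 1 +
      nullCovectorFun a x 3 * radiusGradVec a (E4.spatial x) 2 = 1 := by
  have hr : 0 < radius a (E4.ofTimeSpace 0 (E4.spatial x)) := by
    rwa [radius_ofTimeSpace_spatial]
  have h := radiusGrad_nullSpatial (a := a) (E4.time x) hr
  rw [E4.ofTimeSpace_time_spatial] at h
  rw [radiusGrad_apply] at h
  simp only [PiLp.inner_apply, RCLike.inner_apply, conj_trivial, Fin.sum_univ_three,
    nullSpatial_apply, Fin.succ_zero_eq_one, Fin.succ_one_eq_two, fin_succ_two_eq_three,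
    Fin.isValue] at h
  linear_combination h

/-- `|∇r|² Σ = r² + a²` in components at a point `x` of `E4` with `r > 0`
(`Kerr.inner_radiusGradVec_self`). Visser arXiv:0706.0622, (35). [cite: arXiv07060622, (35)] -/
theorem sum_sq_radiusGradVec_mul_blSigma {a : ℝ} {x : E4} (hx : 0 < radius a x) :
    (radiusGradVec a (E4.spatial x) 0 ^ 2 + radiusGradVec a (E4.spatial x) 1 ^ 2 +
        radiusGradVec a (E4.spatial x) 2 ^ 2) * blSigma a (E4.spatial x) =
      radius a x ^ 2 + a ^ 2 := by
  have hr : 0 < radius a (E4.ofTimeSpace 0 (E4.spatial x)) := by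
    rwa [radius_ofTimeSpace_spatial]
  have hS : 0 < blSigma a (E4.spatial x) := blSigma_pos hr
  have h := inner_radiusGradVec_self (a := a) hr
  rw [radius_ofTimeSpace_spatial, real_inner_self_eq_norm_sq, E3.norm_sq,
    eq_div_iff hS.ne'] at h
  exact h

/-- **The inner boundaries `{r = r_in(t*)}` are achronal with past causal outward conormal when
they recede from the horizon no faster than the outgoing light speed.** Let `x` be a point with
`r = r(x) > 0` of a generalised Kerr–Schild background `g⁻¹ = η⁻¹ − φ ℓ♯ ⊗ ℓ♯` (`ℓ♯` the Kerr
null vector) whose profile at `x` is the Kerr profile, `φ(x) = 2H(x) = 2Mr/Σ` (`M ≥ 0`), and let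
`ν = s dt* − dr`, i.e. `ν₀ = s`, `ν_{i+1} = −∂_i r` with `∇r = Kerr.radiusGradVec`. Then
`Σ g⁻¹(ν, ν) = −(Σ + 2Mr)s² − 4Mrs + Δ(r)` (`|∇r|² = (r² + a²)/Σ`, `ℓ⃗·∇r = 1`,
`Δ = r² − 2Mr + a²`) and `g⁻¹(dt*, ν) = −(1 + 2H)s − 2H`, so that for `s ≥ 0` and
`Δ(r) ≤ 4Mrs` the covector `ν` is causal, `∑ g^{μκ}ν_μν_κ ≤ 0`, and co-oriented with `dt*`,
`∑ g^{0μ}ν_μ ≤ 0`. In the exterior `Δ = (r − r₊)(r − r₋) ≤ r(r − r₊)`, so `s ≥ (r − r₊)/(4M)`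
suffices: hypersurfaces `{r − r₊ = ε e^{t*/(4M)}}` are achronal — the covector form of "past
causal curves in `{r > r₊}` do not reach `𝓗⁺` at finite `t*`", i.e. of the statement that
`{t* = 0} ∩ {r > r₊}` is a past Cauchy hypersurface of `{t* ≥ 0} ∩ {r > r₊}` (DRSR
arXiv:1402.7034, §2.2.5). [cite: DafermosRodnianskiShlapentokhrothman2014, §2.2.5] -/
theorem horizonCovector_causal {M a : ℝ} (hM : 0 ≤ M) {x : E4} (hx : 0 < radius a x)
    {φ : E4 → ℝ} (hφ : φ x = 2 * scalarH M a x) {s : ℝ} (hs : 0 ≤ s)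
    (hΔ : radius a x ^ 2 - 2 * M * radius a x + a ^ 2 ≤ 4 * M * radius a x * s)
    (ν : Fin 4 → ℝ) (hν0 : ν 0 = s) (hν1 : ν 1 = -radiusGradVec a (E4.spatial x) 0)
    (hν2 : ν 2 = -radiusGradVec a (E4.spatial x) 1) (hν3 : ν 3 = -radiusGradVec a (E4.spatial x) 2) :
    (∑ μ, ∑ κ, KerrSchild.inverseMetric φ (nullVector a) x μ κ * ν μ * ν κ ≤ 0) ∧
      (∑ μ, KerrSchild.inverseMetric φ (nullVector a) x 0 μ * ν μ ≤ 0) := by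
  -- the geometric identities at `x`
  have hlg := sum_nullCovectorFun_mul_radiusGradVec hx
  have hgg := sum_sq_radiusGradVec_mul_blSigma hx
  have hSpos : 0 < blSigma a (E4.spatial x) := blSigma_spatial_pos hx
  have hH : φ x * blSigma a (E4.spatial x) = 2 * M * radius a x := by
    rw [hφ, scalarH_eq_div_blSigma M a hx]
    field_simp
  have hf0 : 0 ≤ φ x := by rw [hφ]; exact mul_nonneg zero_le_two (scalarH_nonneg hM a x)
  -- name the atoms
  obtain ⟨g0, hg0⟩ : ∃ g0, radiusGradVec a (E4.spatial x) 0 = g0 := ⟨_, rfl⟩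
  obtain ⟨g1, hg1⟩ : ∃ g1, radiusGradVec a (E4.spatial x) 1 = g1 := ⟨_, rfl⟩
  obtain ⟨g2, hg2⟩ : ∃ g2, radiusGradVec a (E4.spatial x) 2 = g2 := ⟨_, rfl⟩
  obtain ⟨l1, hl1⟩ : ∃ l1, nullCovectorFun a x 1 = l1 := ⟨_, rfl⟩
  obtain ⟨l2, hl2⟩ : ∃ l2, nullCovectorFun a x 2 = l2 := ⟨_, rfl⟩
  obtain ⟨l3, hl3⟩ : ∃ l3, nullCovectorFun a x 3 = l3 := ⟨_, rfl⟩
  obtain ⟨f, hf⟩ : ∃ f, φ x = f := ⟨_, rfl⟩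
  obtain ⟨S, hS⟩ : ∃ S, blSigma a (E4.spatial x) = S := ⟨_, rfl⟩
  obtain ⟨r, hr⟩ : ∃ r, radius a x = r := ⟨_, rfl⟩
  rw [hg0, hg1, hg2, hl1, hl2, hl3] at hlg
  rw [hg0, hg1, hg2, hS, hr] at hgg
  rw [hf, hS, hr] at hH
  rw [hf] at hf0
  rw [hS] at hSpos
  rw [hr] at hΔ hx
  -- the two scalar inequalities
  have key1 : -s ^ 2 + (g0 ^ 2 + g1 ^ 2 + g2 ^ 2) - f * (s + (l1 * g0 + l2 * g1 + l3 * g2)) ^ 2 ≤ 0 := by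
    rw [hlg]
    have hmul : (-s ^ 2 + (g0 ^ 2 + g1 ^ 2 + g2 ^ 2) - f * (s + 1) ^ 2) * S =
        -(S + 2 * M * r) * s ^ 2 - 4 * M * r * s + (r ^ 2 - 2 * M * r + a ^ 2) := by
      linear_combination hgg - (s + 1) ^ 2 * hH
    have hnonpos : (-s ^ 2 + (g0 ^ 2 + g1 ^ 2 + g2 ^ 2) - f * (s + 1) ^ 2) * S ≤ 0 := by
      rw [hmul]
      have h1 : 0 ≤ (S + 2 * M * r) * s ^ 2 := by positivity
      linarith
    by_contra hcon
    have : 0 < (-s ^ 2 + (g0 ^ 2 + g1 ^ 2 + g2 ^ 2) - f * (s + 1) ^ 2) * S :=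
      mul_pos (not_le.mp hcon) hSpos
    linarith
  have key2 : -(1 + f) * s - f * (l1 * g0 + l2 * g1 + l3 * g2) ≤ 0 := by
    rw [hlg]
    nlinarith [mul_nonneg hf0 hs]
  -- expand the contractions
  simp only [KerrSchild.inverseMetric, Kerr.etaComp, Fin.sum_univ_four, Fin.isValue,
    nullVector_apply_zero, nullVector_apply_one, nullVector_apply_two, nullVector_apply_three,
    hν0, hν1, hν2, hν3, hg0, hg1, hg2, hl1, hl2, hl3, hf]
  simp only [show (1 : Fin 4) ≠ 0 from by decide, show (2 : Fin 4) ≠ 0 from by decide,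
    show (3 : Fin 4) ≠ 0 from by decide, show (0 : Fin 4) ≠ 1 from by decide,
    show (0 : Fin 4) ≠ 2 from by decide, show (0 : Fin 4) ≠ 3 from by decide,
    show (1 : Fin 4) ≠ 2 from by decide, show (1 : Fin 4) ≠ 3 from by decide,
    show (2 : Fin 4) ≠ 1 from by decide, show (2 : Fin 4) ≠ 3 from by decide,
    show (3 : Fin 4) ≠ 1 from by decide, show (3 : Fin 4) ≠ 2 from by decide, if_true, if_false]
  constructor
  · linarith [key1]
  · linarith [key2]

/-- **In the exterior, `Δ(r) ≤ r (r − r₊)`**: `Δ = (r − r₊)(r − r₋)` with `0 ≤ r₋ ≤ r₊ < r` for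
subextremal parameters (DRSR arXiv:1402.7034, §2.1.1). Hence the hypothesis `Δ(r) ≤ 4Mrs` of
`horizonCovector_causal` holds as soon as `r − r₊ ≤ 4Ms`. [cite: DafermosRodnianskiShlapentokhrothman2014, §2.1.1] -/
theorem delta_le_mul_sub_rPlus {M a : ℝ} (h : IsSubextremal M a) {r : ℝ} (hr : rPlus M a < r) :
    r ^ 2 - 2 * M * r + a ^ 2 ≤ r * (r - rPlus M a) := by
  rw [← sub_rPlus_mul_sub_rMinus h.sq_lt_sq.le r]
  have h1 : 0 ≤ r - rPlus M a := by linarith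
  have h2 : r - rMinus M a ≤ r := by linarith [h.rMinus_nonneg]
  calc (r - rPlus M a) * (r - rMinus M a) ≤ (r - rPlus M a) * r :=
        mul_le_mul_of_nonneg_left h2 h1
    _ = r * (r - rPlus M a) := by ring

end Literature.Geometry.Lorentzian.Kerr

end
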